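import Summits.ResolutionOfSingularities.ResolutionOfSingularities.Theorems.PurelyInseparableDim4LoopCLocalEscapeUniform
import Summits.ResolutionOfSingularities.ResolutionOfSingularities.Theorems.PurelyInseparableDim4LoopELocalEscape
import HarnessLib

/-!
# [OURS · res-dim4-pi · F4-C-loc] SOURCE LISTS: the exact low-degree coefficients of a point transform over every
  field extension — and a located OBSTRUCTION to the all-fields lift: at LOOP-E's `e3` the points `β = ±i` (`i² = −1`)
  of the `x₁`-chart ARE equimultiple over every field of characteristic 3 containing `√−1`

Cell `res-dim4-pi` (D-0157 DOOR 2, wave 2), seat `res-dim4-p-6` g2, WORD #66 (3).  Extends `UniformNoReply` (p667095: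
maximal witnesses, single sources) to an arbitrary finite SOURCE LIST:

* §1 `IsSource T γ e` (reducible; `γ ≤ e` coordinatewise and `γ = e` off the translated coordinates `T`), Bool certificate
  **`sourcesB q S j T L γ E`** (the list `E` is exactly the set of live sources of `γ` in the chart transform), and
  **`coeff_pointTransform_of_sourcesB`**: for every `f : k →+* K` and every point `b` vanishing off `T`,
  `coeff_{x^γ}(point transform of the lifted state) = Σ_{e ∈ E} f(c_e) · ∏ᵢ C(eᵢ,γᵢ)·bᵢ^{eᵢ−γᵢ}` (Taylor; the tree's
  `WeightedBlowup.coeff_translate_monomial` per source, non-sources contribute nothing by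
  `PointBlowup.le_of/apply_eq_of_coeff_translate_monomial_ne_zero`).
* §2 **`isEquimultiplePoint_of_sources`**: if a source list is certified for EVERY low exponent `γ` (`|γ| < q`, `γ ≠ 0`;
  the finitely many candidates are `lowExps q`) and each listed sum vanishes at `b`, the point `b` IS equimultiple.
* §3 THE OBSTRUCTION (‖ K + symbolic): at p-8 g2's `LoopC.e3` (lone component `V(x₁,x₃)`, `x₁`-chart, fibre
  coordinate `β` on `x₃`) the only low-degree monomial with a source is `x₁²`, sources `x₁²x₃²`, `x₁²x₃⁴` (both
  coefficient `1`), so `coeff_{x₁²} = β² + β⁴ = β²(1 + β²)`; **`isEquimultiplePoint_e3_of_sq_eq_neg_one`**: for every field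
  `L` of characteristic 3 and every `i ∈ L` with `i² = −1`, the local reply `b = (0,0,i,0)` IS equimultiple for the
  lifted `e3` — the `𝔽₃` local certificate `loopE_localWins` (p668190, only `β = 0` replies) does NOT lift to `𝔽₉`
  by the replies-only method; the «`𝔽₃`-rational replies» rider on the LOOP-E local row is REAL.  (Whether A still wins
  locally over `𝔽₉` from `e3` — the new children are ISOLATED `3`-fold points, F4-I territory — is not decided here.)

Scope (honest): a symbolic coefficient law and one located specimen; statements about OUR frame; nothing here decides
F4-C-loc(3,3); NOTHING here is a statement about resolution of singularities — resolution in dimension `≥ 4` /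
characteristic `p > 0` is NOT proved by anything in this file.  [OURS · counted 0; AI kernel work, weaker than expert
review.]  bears_on: LADDER-RESOLUTION:D157-DOOR2 (res-dim4-pi · F4-C-loc(3,3) field ascent).  Host item (DR-157-C):
`stmt-ResolutionOfSingularities-16155`, helper.
-/

set_option linter.dupNamespace false -- mandated namespace of this single-conjunct summit

noncomputable section

open MvPolynomial Finset
open scoped BigOperators

namespace Summit.ResolutionOfSingularities.ResolutionOfSingularities.Theorems.PIDim4

namespace UniformNoReply

open Literature.AlgebraicGeometry.Resolution
open Literature.AlgebraicGeometry.Resolution.CentreBlowup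
open StepKit

variable {k K : Type} [Field k] [Field K] [DecidableEq k] [DecidableEq K] (f : k →+* K)

/-! ## §1 Source lists and the exact coefficient -/

/-- `e` is a SOURCE of `γ` under translations of the coordinates `T`: `γ ≤ e` and `γ = e` off `T`. OURS. [folklore] -/
abbrev IsSource (T : Finset (Fin 4)) (γ e : Fin 4 → ℕ) : Prop :=
  (∀ i, γ i ≤ e i) ∧ ∀ m, m ∉ T → γ m = e m

/-- **Source-list certificate**: `E` is duplicate-free, every member is a live source of `γ` in the chart transform,
and every live source is a member. OURS. [folklore] -/
def sourcesB (q : ℕ) (S : Finset (Fin 4)) (j : Fin 4) (T : Finset (Fin 4)) (L : Terms 4 k)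
    (γ : Fin 4 → ℕ) (E : List (Fin 4 → ℕ)) : Bool :=
  decide E.Nodup && (E.all fun e => decide (e ∈ live (chartL q S j L)) && decide (IsSource T γ e)) &&
    ((live (chartL q S j L)).all fun e' => decide (IsSource T γ e' → e' ∈ E))

/-- the Taylor term of one source at the point `b`. OURS. [folklore] -/
def sourceTerm (f : k →+* K) (L : Terms 4 k) (γ : Fin 4 → ℕ) (b : Fin 4 → K) (e : Fin 4 → ℕ) : K :=
  f (coeffAt L e) * ∏ i, (((e i).choose (γ i) : K) * b i ^ (e i - γ i))

omit [DecidableEq K] in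
/-- **The exact coefficient of `x^γ` in the point transform of a lifted state**, at every point `b` vanishing off
`T`, over every field: the sum of the Taylor terms of the certified sources. OURS. [folklore] -/
theorem coeff_pointTransform_of_sourcesB {q : ℕ} {S T : Finset (Fin 4)} {j : Fin 4} {s : SData 4 k}
    {γ : Fin 4 → ℕ} {E : List (Fin 4 → ℕ)} (h : sourcesB q S j T s.L γ E = true) {b : Fin 4 → K}
    (hb : ∀ m, m ∉ T → b m = 0) :
    coeff (expo γ) (pointTransform q S j b
        (⟨MvPolynomial.map f s.toState.F, s.toState.r, s.toState.exc⟩ : State K)) =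
      (E.map (sourceTerm f (chartL q S j s.L) γ b)).sum := by
  classical
  simp only [sourcesB, Bool.and_eq_true, decide_eq_true_eq, List.all_eq_true] at h
  obtain ⟨⟨hnodup, hE⟩, hall⟩ := h
  rw [pointTransform_baseChange_evalT]
  set Lc := chartL q S j s.L with hLc
  set P : MvPolynomial (Fin 4) K := MvPolynomial.map f (evalT Lc) with hP
  -- the Taylor sum over the support of `P`
  rw [PointBlowup.translate_eq_sum_support, coeff_sum]
  have hcoeffP : ∀ e : Fin 4 → ℕ, coeff (expo e) P = f (coeffAt Lc e) := fun e => by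
    rw [hP, coeff_map, coeff_expo_evalT]
  -- non-sources contribute nothing
  have hvanish : ∀ e' ∈ P.support, e' ∉ (E.map expo).toFinset →
      coeff (expo γ) (PointBlowup.translate b (monomial e' (coeff e' P))) = 0 := by
    intro e' he' hnot
    by_contra hc
    have hle := PointBlowup.le_of_coeff_translate_monomial_ne_zero b hc
    have hagree := fun m (hm : b m = 0) => PointBlowup.apply_eq_of_coeff_translate_monomial_ne_zero b hm hc
    have he'' : (⇑e') ∈ live Lc := by
      have := support_map_subset _ _ he'
      rwa [mem_support_evalT_iff] at this
    have hsrc : IsSource T γ ⇑e' :=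
      ⟨fun i => by simpa using hle i, fun m hm => by have := hagree m (hb m hm); simpa using this⟩
    apply hnot
    rw [List.mem_toFinset, List.mem_map]
    exact ⟨⇑e', hall _ he'' hsrc, expo_coe e'⟩
  -- the sources lie in the support (`f` injective)
  have hsub : (E.map expo).toFinset ⊆ P.support := by
    intro x hx
    rw [List.mem_toFinset, List.mem_map] at hx
    obtain ⟨e, he, rfl⟩ := hx
    have hlive := (hE e he).1
    rw [MvPolynomial.mem_support_iff, hcoeffP, map_ne_zero_iff f f.injective]
    have := (expo_mem_support_iff Lc e).mpr hlive
    rwa [MvPolynomial.mem_support_iff, coeff_expo_evalT] at this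
  rw [← Finset.sum_subset hsub (fun e' he' hnot => hvanish e' he' hnot)]
  have hnodup' : (E.map expo).Nodup := hnodup.map fun a b hab => expo_inj.mp hab
  rw [List.sum_toFinset _ hnodup', List.map_map]
  refine congrArg List.sum (List.map_congr_left fun e _ => ?_)
  show coeff (expo γ) (PointBlowup.translate b (monomial (expo e) (coeff (expo e) P))) = sourceTerm f Lc γ b e
  rw [WeightedBlowup.coeff_translate_monomial, hcoeffP]
  rfl

/-! ## §2 Equimultiplicity from vanishing source sums -/

/-- the finitely many exponents with all coordinates `< q` (every `γ` with `|γ| < q` is among them). OURS. [folklore] -/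
def lowExps (q : ℕ) : Finset (Fin 4 → ℕ) :=
  (Finset.univ : Finset (Fin 4 → Fin q)).image fun g i => (g i : ℕ)

/-- an exponent of total degree `< q` lies in `lowExps q`. OURS. [folklore] -/
theorem mem_lowExps_of_sum_lt {q : ℕ} {γ : Fin 4 → ℕ} (h : (∑ i, γ i) < q) : γ ∈ lowExps q := by
  have hlt : ∀ i, γ i < q := fun i =>
    lt_of_le_of_lt (Finset.single_le_sum (f := γ) (fun _ _ => Nat.zero_le _) (Finset.mem_univ i)) h
  unfold lowExps
  rw [Finset.mem_image]
  exact ⟨fun i => ⟨γ i, hlt i⟩, Finset.mem_univ _, funext fun i => rfl⟩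

omit [DecidableEq K] in
/-- **Equimultiplicity by source lists**: if for every low exponent `γ` (`γ ∈ lowExps q`, `γ ≠ 0`, `|γ| < q`) a source list
`Es γ` is certified and its Taylor sum vanishes at `b` (only the non-empty lists need a computation), then `b` is an
EQUIMULTIPLE point of the lifted state. OURS. [folklore] -/
theorem isEquimultiplePoint_of_sources {q : ℕ} {S T : Finset (Fin 4)} {j : Fin 4} {s : SData 4 k}
    (Es : (Fin 4 → ℕ) → List (Fin 4 → ℕ))
    (hcert : ∀ γ ∈ lowExps q, γ ≠ 0 → (∑ i, γ i) < q → sourcesB q S j T s.L γ (Es γ) = true)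
    {b : Fin 4 → K} (hb : ∀ m, m ∉ T → b m = 0)
    (hsum : ∀ γ, Es γ ≠ [] → ((Es γ).map (sourceTerm f (chartL q S j s.L) γ b)).sum = 0) :
    IsEquimultiplePoint q S j b
      (⟨MvPolynomial.map f s.toState.F, s.toState.r, s.toState.exc⟩ : State K) := by
  intro d hd0 hdeg
  have hsumlt : (∑ i, (⇑d) i) < q := by rw [← degree_expo ⇑d, expo_coe]; exact hdeg
  have hγ0 : (⇑d : Fin 4 → ℕ) ≠ 0 := fun h => hd0 (by rw [← expo_coe d, h]; exact (expo_eq_zero_iff _).mpr rfl)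
  have h := coeff_pointTransform_of_sourcesB f (hcert (⇑d) (mem_lowExps_of_sum_lt hsumlt) hγ0 hsumlt) hb
  rw [expo_coe] at h
  rw [h]
  by_cases hne : Es ⇑d = []
  · rw [hne, List.map_nil, List.sum_nil]
  · exact hsum _ hne

/-! ## §3 The obstruction at LOOP-E's `e3` -/

/-- At `e3`, lone component `V(x₁,x₃)` (`{0,2}`), `x₁`-chart, fibre coordinate on `x₃`: the source lists of the low
exponents — `x₁²` has the two sources `x₁²x₃²`, `x₁²x₃⁴`; every other low exponent has none. [OURS · data] -/
def e3Sources (γ : Fin 4 → ℕ) : List (Fin 4 → ℕ) :=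
  if γ = ![2, 0, 0, 0] then [![2, 0, 2, 0], ![2, 0, 4, 0]] else []

/-- The source lists check for every low exponent. [OURS · ‖ K] -/
theorem sourcesB_e3 : ∀ γ ∈ lowExps 3, γ ≠ 0 → (∑ i, γ i) < 3 →
    sourcesB 3 {0, 2} 0 (({0, 2} : Finset (Fin 4)).erase 0) LoopC.e3.L γ (e3Sources γ) = true := by
  decide +kernel

/-- The two source coefficients are `1`. [OURS · ‖ K] -/
theorem coeffAt_e3_sources :
    coeffAt (chartL 3 {0, 2} 0 LoopC.e3.L) ![2, 0, 2, 0] = 1 ∧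
      coeffAt (chartL 3 {0, 2} 0 LoopC.e3.L) ![2, 0, 4, 0] = 1 := by
  decide +kernel

/-- **THE OBSTRUCTION: over every field `L` of characteristic 3 containing `i` with `i² = −1`, the point `(0,0,i,0)` of the
`x₁`-chart of the blow-up of `V(x₁,x₃)` at the lifted `e3` IS EQUIMULTIPLE** (the `x₁²`-coefficient is
`i² + i⁴ = −1 + 1 = 0`, all other low-degree coefficients vanish identically).  So B has a LOCAL reply over `𝔽₉` that
does not exist over `𝔽₃`. [OURS · ‖ K + symbolic] -/
theorem isEquimultiplePoint_e3_of_sq_eq_neg_one (L : Type) [Field L] [CharP L 3] {i : L} (hi : i * i = -1) :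
    IsEquimultiplePoint 3 {0, 2} 0 (fun m : Fin 4 => if m = 2 then i else 0)
      (LoopCLocal.liftState L LoopC.e3.toState) := by
  refine isEquimultiplePoint_of_sources (LoopCLocal.φ3 L) e3Sources sourcesB_e3 (fun m hm => ?_) ?_
  · have : m ≠ 2 := fun h => hm (by rw [h]; decide)
    simp [this]
  · intro γ hne
    unfold e3Sources at hne ⊢
    by_cases hγ : γ = ![2, 0, 0, 0]
    · subst hγ
      rw [if_pos rfl]
      obtain ⟨h1, h2⟩ := coeffAt_e3_sources
      simp only [List.map_cons, List.map_nil, List.sum_cons, List.sum_nil, sourceTerm, h1, h2, map_one, one_mul,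
        add_zero]
      simp [Fin.prod_univ_four]
      -- `i ^ 2 + i ^ 4 = 0` from `i * i = -1`
      have h2' : i ^ 2 = -1 := by rw [pow_two]; exact hi
      have h4 : i ^ 4 = 1 := by
        rw [show (4 : ℕ) = 2 * 2 from rfl, pow_mul, h2']; norm_num
      rw [h2', h4]; norm_num
    · exfalso
      rw [if_neg hγ] at hne
      exact hne rfl

/-- … hence the replies-only lift FAILS at `e3`: there is a field of characteristic 3 (any `L ∋ √−1`, e.g. `𝔽₉`) and a
LOCAL reply at the lifted `e3` that is not the chart origin. OURS. [folklore] -/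
theorem exists_nonorigin_local_reply_e3 (L : Type) [Field L] [CharP L 3] {i : L} (hi : i * i = -1) :
    ∃ b : Fin 4 → L, b ≠ 0 ∧ b 0 = 0 ∧ (∀ m : Fin 4, m ∉ ({0, 2} : Finset (Fin 4)) → b m = 0) ∧
      IsEquimultiplePoint 3 {0, 2} 0 b (LoopCLocal.liftState L LoopC.e3.toState) := by
  have hi0 : i ≠ 0 := by
    intro h; rw [h, mul_zero] at hi; exact absurd hi.symm (by norm_num)
  refine ⟨fun m => if m = 2 then i else 0, fun h => hi0 (by simpa using congrFun h 2), by simp, fun m hm => ?_,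
    isEquimultiplePoint_e3_of_sq_eq_neg_one L hi⟩
  have : m ≠ 2 := fun h => hm (by rw [h]; decide)
  simp [this]

end UniformNoReply

end Summit.ResolutionOfSingularities.ResolutionOfSingularities.Theorems.PIDim4

end
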